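import Mathlib
import HarnessLib
import Summits.RiemannHypothesis.RiemannHypothesis.Theorems.IntegerScrewRungCertWide

/-!
# Route `IntegerScrew` — kernel certificate checker for the finite rungs: the WIDE PATH (any `N`), 2/2

The decision step and the main soundness theorem of the wide path (part 1: `IntegerScrewRungCertWide`, the
entry enclosures `uTableW` on validated von Mangoldt / square-root tables):

* `dotZ` / `zresidualW` / `zcheckW` — the integer domination test of `IntegerScrewRungCertFast` with the Gram
  products `(L Lᵀ)_{ij}` computed by ONE simultaneous traversal of the two ragged rows (`dotZ_eq_sum`,
  `zcheck_of_zcheckW`: same verdict as the tree's `zcheck` when every row of `Lz` has length `≤ n`, `lzOK`);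
* `zrowW` — the row tests of that check in indexed form (`zcheck_of_zrowW`); they are decided in ROW CHUNKS
  so that no single kernel computation exceeds about a minute (longer monolithic `decide`s fail on the farm);
* `zrowS` / `zcheckRowsS` — the STREAMED row tests (one simultaneous pass over the row of `T` — built by
  `trowGo` from three list cursors — and the rows of the factor; no indexed access in the inner loop; the
  symmetry of the data, `tEnclF_symm` / `zresidualW_symm`, turns the half Gershgorin sum into the full one:
  `zrowW_of_zrowS`, `zrowW_of_rowsS`) — the form actually decided for `S_128`;
* `rungLightW` + **`posDef_of_rungW`**: tables validated, logarithms the engine's, factor rows short, bound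
  positive; with every row test passed, `slopeEncl logs = some A` and the table identity
  `utab = uTableW lam sqs logs A N ktab` (row chunks, glued by `drop_eq_of_chunk` and `list_eq_of_chunks₂`),
  `screwMatrix N ≻ 0` follows for ANY `N` by the rank-one trick on `T(c_lo)` exactly as in
  `IntegerScrewRungCertSound` / `…Fast` (soundness of the decision step = the tree's real lemma
  `Literature.Analysis.ValidatedNumerics.mul_sqSum_le_quadForm_of_residual` via `mul_sqSum_le_quadForm_of_zcheck`).

Nothing here bears on the truth of RH (every rung is an RH-consequence made unconditional by computation).
References: S. M. Rump, Acta Numerica 19 (2010) §10.8 [folklore]; M. Suzuki, J. Lond. Math. Soc. (2) 108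
(2023), (1.1), (1.4) [Suzuki2023].
-/

set_option linter.dupNamespace false

namespace Summit.RiemannHypothesis.RiemannHypothesis.Theorems.IntegerScrew.RungCert

open Literature.NumberTheory.LFunctions Literature.Analysis.ValidatedNumerics Finset
open Literature.Analysis.ValidatedNumerics.Numerics

/-! ## Integer decision step with simultaneous row traversal -/

/-- `Σ_m x_m y_m` over the common prefix of two lists. [folklore] -/
def dotZ : List ℤ → List ℤ → ℤ
  | [], _ => 0
  | _ :: _, [] => 0
  | x :: xs, y :: ys => x * y + dotZ xs ys

/-- Every row of the factor has length `≤ n`. [folklore] -/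
def lzOK (Lz : List (List ℤ)) (n : ℕ) : Bool := Lz.all fun row => decide (row.length ≤ n)

/-- The integer residual `2^64·(C − L Lᵀ − λ I)` with `(L Lᵀ)_{ij}` by `dotZ` on the rows. [folklore] -/
def zresidualW (cz : ℕ → ℕ → ℤ) (Lz : List (List ℤ)) (lamZ : ℤ) (i j : ℕ) : ℤ :=
  cz i j * 32768 - dotZ (Lz.getD i []) (Lz.getD j []) - (if i = j then lamZ * 32768 else 0)

/-- The domination test of `zcheck` on `zresidualW`. [folklore] -/
def zcheckW (n : ℕ) (cz rz : ℕ → ℕ → ℤ) (Lz : List (List ℤ)) (lamZ : ℤ) : Bool :=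
  let R := mtab n n (zresidualW cz Lz lamZ)
  rall n fun i => decide
    (rsum n (fun j => if j = i then 0 else |mget R i j| + |mget R j i|) +
        32768 * rsum n (fun j => rz i j + rz j i) ≤ 2 * mget R i i)

/-- `dotZ` is the sum over any range covering one of the two lists. [folklore] -/
theorem dotZ_eq_sum : ∀ (l l' : List ℤ) (n : ℕ), (l.length ≤ n ∨ l'.length ≤ n) →
    dotZ l l' = ∑ m ∈ range n, l.getD m 0 * l'.getD m 0
  | [], l', n, _ => by simp [dotZ]
  | x :: xs, [], n, _ => by simp [dotZ]
  | x :: xs, y :: ys, n, h => by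
    obtain ⟨n, rfl⟩ : ∃ k, n = k + 1 := ⟨n - 1, by simp only [List.length_cons] at h; omega⟩
    rw [dotZ, Finset.sum_range_succ', dotZ_eq_sum xs ys n (by simp only [List.length_cons] at h; omega)]
    simp [add_comm]

/-- Rows of a validated factor are short. [folklore] -/
theorem length_le_of_lzOK {Lz : List (List ℤ)} {n : ℕ} (h : lzOK Lz n = true) (i : ℕ) :
    (Lz.getD i []).length ≤ n := by
  rw [List.getD_eq_getElem?_getD]
  cases hi : Lz[i]? with
  | none => simp
  | some row =>
    simp only [Option.getD_some]
    have hmem : row ∈ Lz := List.mem_of_getElem? hi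
    simpa using List.all_eq_true.1 h row hmem

/-- `zresidualW = zresidual` on short rows. [folklore] -/
theorem zresidualW_eq {n : ℕ} {cz : ℕ → ℕ → ℤ} {Lz : List (List ℤ)} {lamZ : ℤ} (h : lzOK Lz n = true) :
    zresidualW cz Lz lamZ = zresidual n cz Lz lamZ := by
  funext i j
  unfold zresidualW zresidual mget
  rw [dotZ_eq_sum _ _ n (Or.inl (length_le_of_lzOK h i)), rsum_eq_sum]

/-- **Same verdict as the tree's `zcheck`.** [folklore] -/
theorem zcheck_of_zcheckW {n : ℕ} {cz rz : ℕ → ℕ → ℤ} {Lz : List (List ℤ)} {lamZ : ℤ}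
    (hL : lzOK Lz n = true) (h : zcheckW n cz rz Lz lamZ = true) : zcheck n cz rz Lz lamZ = true := by
  unfold zcheckW at h
  rw [zresidualW_eq hL] at h
  exact h

/-! ## The wide rung checker and its soundness -/

/-- Scaled centre `lo + hi` of the entry `(i, j)` of `T(c_lo)` (scale `2^49`). [folklore] -/
def czOf (utab : List (List FI)) (N : ℕ) (i j : ℕ) : ℤ := (pg (tzTab utab N) i j).1

/-- Scaled width `hi − lo` of the entry `(i, j)` of `T(c_lo)` (scale `2^49`). [folklore] -/
def rzOf (utab : List (List FI)) (N : ℕ) (i j : ℕ) : ℤ := (pg (tzTab utab N) i j).2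

/-- The row test `i` of the integer domination check on the table data. [folklore] -/
def zrowW (N : ℕ) (utab : List (List FI)) (Lz : List (List ℤ)) (lamZ : ℤ) (i : ℕ) : Bool :=
  let R := mtab N N (zresidualW (czOf utab N) Lz lamZ)
  decide (rsum N (fun j => if j = i then 0 else |mget R i j| + |mget R j i|) +
      32768 * rsum N (fun j => rzOf utab N i j + rzOf utab N j i) ≤ 2 * mget R i i)

/-- All rows decided ⇒ the tree's `zcheck` passes on the table data. [folklore] -/
theorem zcheck_of_zrowW {N : ℕ} {utab : List (List FI)} {Lz : List (List ℤ)} {lamZ : ℤ}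
    (hL : lzOK Lz N = true) (h : ∀ i < N, zrowW N utab Lz lamZ i = true) :
    zcheck N (czOf utab N) (rzOf utab N) Lz lamZ = true := by
  refine zcheck_of_zcheckW hL (rall_eq_true_iff.2 fun i hi => ?_)
  exact h i hi

/-- **The wide rung checker, light part** (any `N`): the von Mangoldt and square-root tables are validated
up to `N + 1`, the logarithm table is the engine's, the factor rows are short, the bound is positive. The
integer domination test (`zrowW`, in row chunks) and the table identity `utab = uTableW lam sqs logs A N ktab`
(in row chunks) are supplied separately. [folklore] -/
def rungLightW (N : ℕ) (lam : List (ℕ × ℕ × ℕ)) (sqs logs : List FI) (Lz : List (List ℤ)) (lamZ : ℤ) :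
    Bool :=
  lamTabOK lam (N + 1) && sqrtTabOK sqs (N + 1) && decide (logs = FI.logTable (N + 1)) &&
    FI.logTableOK (N + 1) && lzOK Lz N && decide (0 < lamZ)

/-- **Soundness of the wide rung checker**: the light part, all row tests of the integer domination check,
`slopeEncl logs = some A` and the table identity `utab = uTableW lam sqs logs A N ktab` (any term counts
`ktab`) imply `S_{N+1} = screwMatrix N ≻ 0` — unconditionally, for any `N`. [folklore] -/
theorem posDef_of_rungW {N : ℕ} {lam : List (ℕ × ℕ × ℕ)} {sqs logs : List FI} {utab : List (List FI)}
    {Lz : List (List ℤ)} {lamZ : ℤ} (h : rungLightW N lam sqs logs Lz lamZ = true)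
    (hz : ∀ i < N, zrowW N utab Lz lamZ i = true) {A : FI} (hA : slopeEncl logs = some A)
    {ktab : List (List ℕ)} (htab : utab = uTableW lam sqs logs A N ktab) : (screwMatrix N).PosDef := by
  rcases Nat.eq_zero_or_pos N with rfl | hNpos
  · exact screwMatrix_zero_posDef
  unfold rungLightW at h
  simp only [Bool.and_eq_true, decide_eq_true_eq] at h
  obtain ⟨⟨⟨⟨⟨hlam, hsq⟩, hlogs⟩, hok⟩, hlz⟩, hpos⟩ := h
  have hL := logsOK_of_eq hlogs hok
  have hΛ := fun n hn => lamTabOK_sound hlam (n := n) hn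
  have hS := fun n hn => mem_of_sqrtTabOK hsq (n := n) hn
  have hAv : FI.mem slopeA A := mem_slopeEncl hL (by omega) hA
  have hut : ∀ a b : ℕ, 0 < b → b < a → a ≤ N + 1 → FI.mem (uR a b) (ug utab a b) := by
    intro a b hb hba ha
    rw [htab, ug_uTableW hba ha]
    exact mem_uEnclW hΛ hS hL hAv hb hba ha _
  have hcheck' := zcheck_of_zrowW hlz hz
  have hform : ∀ v : Fin N → ℝ, ((lamZ : ℤ) : ℝ) / (2 * SC) * dotProduct v v ≤
      dotProduct v ((tMat ((cLoF : ℚ) : ℝ) N).mulVec v) := by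
    intro v
    rw [← quadForm_pad, ← sqSum_pad]
    refine mul_sqSum_le_quadForm_of_zcheck hcheck' (fun i hi j hj => ?_) _
    have hi' := mem_range.1 hi; have hj' := mem_range.1 hj
    unfold czOf rzOf
    rw [padM_of_lt _ hi' hj', pg_tzTab utab hi' hj']
    exact abs_sub_le_of_mem (mem_tEnclF hut hi' hj')
  have hlam' : (0 : ℝ) < ((lamZ : ℤ) : ℝ) / (2 * SC) := by
    have : (0 : ℝ) < ((lamZ : ℤ) : ℝ) := by exact_mod_cast hpos
    exact div_pos this (mul_pos two_pos SC_pos)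
  have hpd : (tMat ((cLoF : ℚ) : ℝ) N).PosDef := by
    refine Matrix.PosDef.of_dotProduct_mulVec_pos (tMat_isHermitian _ _) fun v hv => ?_
    have hvv : 0 < dotProduct v v := by
      have := Matrix.dotProduct_star_self_pos_iff.mpr hv
      simpa using this
    have := hform v
    rw [star_trivial]
    exact lt_of_lt_of_le (mul_pos hlam' hvv) this
  rw [screwMatrix_eq_tMat, tMat_split lerchC ((cLoF : ℚ) : ℝ)]
  exact hpd.add_posSemidef ((one_add_vecMulVec_posSemidef N).smul
    (div_nonneg (sub_nonneg.2 cLoF_le_lerchC) (by norm_num)))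

/-- Corollary: pivots. [folklore] -/
theorem screwPivot_pos_of_rungW {N : ℕ} {lam : List (ℕ × ℕ × ℕ)} {sqs logs : List FI}
    {utab : List (List FI)} {Lz : List (List ℤ)} {lamZ : ℤ} (h : rungLightW N lam sqs logs Lz lamZ = true)
    (hz : ∀ i < N, zrowW N utab Lz lamZ i = true) {A : FI} (hA : slopeEncl logs = some A)
    {ktab : List (List ℕ)} (htab : utab = uTableW lam sqs logs A N ktab) {M : ℕ} (hM : 2 ≤ M)
    (hMN : M ≤ N + 1) : 0 < screwPivot M :=
  screwPivot_pos_of_posDef_le (posDef_of_rungW h hz hA htab) M hM hMN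

/-! ## Streamed row tests (one simultaneous pass per row — no indexed access in the inner loop) -/

/-- `dotZ` is symmetric. [folklore] -/
theorem dotZ_comm : ∀ l l' : List ℤ, dotZ l l' = dotZ l' l
  | [], [] => rfl
  | [], _ :: _ => rfl
  | _ :: _, [] => rfl
  | x :: xs, y :: ys => by rw [dotZ, dotZ, mul_comm, dotZ_comm xs ys]

/-- `tEnclF` is symmetric (interval addition is componentwise). [folklore] -/
theorem tEnclF_symm (utab : List (List FI)) (i j : ℕ) : tEnclF utab i j = tEnclF utab j i := by
  rcases eq_or_ne i j with rfl | h
  · rfl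
  · unfold tEnclF
    rw [if_neg h, if_neg (Ne.symm h), max_comm, min_comm]
    congr 1
    simp only [FI.add, FI.mk.injEq]
    constructor <;> ring

/-- The scaled centres are symmetric. [folklore] -/
theorem czOf_symm (utab : List (List FI)) {N i j : ℕ} (hi : i < N) (hj : j < N) :
    czOf utab N i j = czOf utab N j i := by
  unfold czOf; rw [pg_tzTab utab hi hj, pg_tzTab utab hj hi, tEnclF_symm]

/-- The scaled widths are symmetric. [folklore] -/
theorem rzOf_symm (utab : List (List FI)) {N i j : ℕ} (hi : i < N) (hj : j < N) :
    rzOf utab N i j = rzOf utab N j i := by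
  unfold rzOf; rw [pg_tzTab utab hi hj, pg_tzTab utab hj hi, tEnclF_symm]

/-- The integer residual on the table data is symmetric. [folklore] -/
theorem zresidualW_symm (utab : List (List FI)) (Lz : List (List ℤ)) (lamZ : ℤ) {N i j : ℕ} (hi : i < N)
    (hj : j < N) : zresidualW (czOf utab N) Lz lamZ i j = zresidualW (czOf utab N) Lz lamZ j i := by
  unfold zresidualW
  rw [czOf_symm utab hi hj, dotZ_comm]
  rcases eq_or_ne i j with rfl | h
  · rfl
  · rw [if_neg h, if_neg (Ne.symm h)]

/-- The first column `u(j+2, 1)`, `j = 0, 1, …`, read off once. [folklore] -/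
def dcol (utab : List (List FI)) : List FI := (utab.drop 2).map fun r => r.getD 1 (FI.ofInt 0)

/-- Row `i` of the interval table of `T(c_lo)` by ONE simultaneous pass over three cursors: `D` (first
column from `j`), `U` (row `i+2` of `utab` from entry `j+2`), `H` (rows of `utab` from `j+2`). [folklore] -/
def trowGo (c4 c2 Di : FI) (i : ℕ) : ℕ → List FI → List FI → List (List FI) → List FI
  | _, [], _, _ => []
  | j, Dj :: Ds, U, H =>
      (if j < i then ((c4.add Di).add Dj).sub (U.headD (FI.ofInt 0))
        else if j = i then c2.add (Di.mulInt 2)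
        else ((c4.add Di).add Dj).sub ((H.headD []).getD (i + 2) (FI.ofInt 0))) ::
      trowGo c4 c2 Di i (j + 1) Ds (U.drop 1) (H.drop 1)

/-- Row `i` of the interval table of `T(c_lo)` (streamed; `D = dcol utab`). [folklore] -/
def trowD (utab : List (List FI)) (D : List FI) (i : ℕ) : List FI :=
  trowGo (FI.ofRatRat (cLoF / 4) (cLoF / 4)) (FI.ofRatRat (cLoF / 2) (cLoF / 2)) (D.getD i (FI.ofInt 0)) i 0 D
    ((utab.getD (i + 2) []).drop 2) (utab.drop 2)

/-- The row accumulator: `acc + Σ_j ([j ≠ i]·|R_{ij}| + 2^15·width_{ij})` along the row of `T` and the rows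
of the factor (`R_{ij} = 2^64 (C − L Lᵀ − λ I)_{ij}` as in `zresidualW`). [folklore] -/
def rowFold (Li : List ℤ) (lamZ : ℤ) (i : ℕ) : ℕ → List FI → List (List ℤ) → ℤ → ℤ
  | j, t :: ts, Lj :: Ls, acc =>
      rowFold Li lamZ i (j + 1) ts Ls
        (acc + (if j = i then 0 else |(t.lo + t.hi) * 32768 - dotZ Li Lj - (if i = j then lamZ * 32768 else 0)|) +
          32768 * (t.hi - t.lo))
  | _, _, _, acc => acc

/-- **Streamed row test `i`** (symmetric form): `Σ_{j ≠ i} |R_{ij}| + 2^15 Σ_j width_{ij} ≤ R_{ii}`. [folklore] -/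
def zrowS (utab : List (List FI)) (D : List FI) (Lz : List (List ℤ)) (lamZ : ℤ) (i : ℕ) : Bool :=
  let tr := trowD utab D i
  let Li := Lz.getD i []
  let ti := tr.getD i (FI.ofInt 0)
  decide (rowFold Li lamZ i 0 tr Lz 0 ≤ (ti.lo + ti.hi) * 32768 - dotZ Li Li - lamZ * 32768)

/-- **A chunk of streamed row tests**, rows `i₀ ≤ i < i₀ + cnt` (with the two length guards). [folklore] -/
def zcheckRowsS (N : ℕ) (utab : List (List FI)) (Lz : List (List ℤ)) (lamZ : ℤ) (i₀ cnt : ℕ) : Bool :=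
  let D := dcol utab
  decide (utab.length = N + 2) && decide (Lz.length = N) && rall cnt fun t => zrowS utab D Lz lamZ (i₀ + t)

/-- Length of the streamed row. [folklore] -/
theorem trowGo_length (c4 c2 Di : FI) (i : ℕ) : ∀ (Ds : List FI) (j : ℕ) (U : List FI) (H : List (List FI)),
    (trowGo c4 c2 Di i j Ds U H).length = Ds.length
  | [], j, U, H => by simp [trowGo]
  | Dj :: Ds, j, U, H => by simp [trowGo, trowGo_length c4 c2 Di i Ds]

/-- Entries of the streamed row. [folklore] -/
theorem trowGo_getElem (c4 c2 Di : FI) (i : ℕ) : ∀ (Ds : List FI) (j : ℕ) (U : List FI) (H : List (List FI))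
    (t : ℕ), t < Ds.length →
    (trowGo c4 c2 Di i j Ds U H)[t]? = some
      (if j + t < i then ((c4.add Di).add (Ds.getD t (FI.ofInt 0))).sub ((U.drop t).headD (FI.ofInt 0))
        else if j + t = i then c2.add (Di.mulInt 2)
        else ((c4.add Di).add (Ds.getD t (FI.ofInt 0))).sub (((H.drop t).headD []).getD (i + 2) (FI.ofInt 0)))
  | [], j, U, H, t, ht => by simp at ht
  | Dj :: Ds, j, U, H, 0, _ => by simp [trowGo]
  | Dj :: Ds, j, U, H, t + 1, ht => by
    rw [trowGo, List.getElem?_cons_succ,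
      trowGo_getElem c4 c2 Di i Ds (j + 1) (U.drop 1) (H.drop 1) t (by simpa using ht)]
    have e : j + 1 + t = j + (t + 1) := by omega
    simp only [List.drop_drop, e, List.getD_cons_succ, Nat.add_comm 1 t]

/-- Reading the first column. [folklore] -/
theorem dcol_getD (utab : List (List FI)) {j : ℕ} (h : j + 2 < utab.length) :
    (dcol utab).getD j (FI.ofInt 0) = ug utab (j + 2) 1 := by
  simp only [dcol, ug, List.getD_eq_getElem?_getD, List.getElem?_map, List.getElem?_drop, Nat.add_comm 2 j]
  cases hr : utab[j + 2]? with
  | none => exact absurd (List.getElem?_eq_none_iff.1 hr) (by omega)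
  | some row => simp

/-- **The streamed row is the row of `tEnclF`.** [folklore] -/
theorem trowD_getD {utab : List (List FI)} {N i j : ℕ} (hlen : utab.length = N + 2) (hi : i < N) (hj : j < N) :
    (trowD utab (dcol utab) i).getD j (FI.ofInt 0) = tEnclF utab i j := by
  have hD : (dcol utab).length = N := by simp [dcol, hlen]
  unfold trowD
  rw [List.getD_eq_getElem?_getD, trowGo_getElem _ _ _ _ _ _ _ _ j (by omega), Option.getD_some, Nat.zero_add,
    dcol_getD utab (j := i) (by omega), dcol_getD utab (j := j) (by omega)]
  have hU : (((utab.getD (i + 2) []).drop 2).drop j).headD (FI.ofInt 0) = ug utab (i + 2) (j + 2) := by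
    simp only [List.headD_eq_head?_getD, List.drop_drop, List.head?_drop, ug, List.getD_eq_getElem?_getD,
      Nat.add_comm 2 j]
  have hH : (((utab.drop 2).drop j).headD []).getD (i + 2) (FI.ofInt 0) = ug utab (j + 2) (i + 2) := by
    simp only [List.headD_eq_head?_getD, List.drop_drop, List.head?_drop, ug, List.getD_eq_getElem?_getD,
      Nat.add_comm 2 j]
  rw [hU, hH]
  unfold tEnclF
  rcases lt_trichotomy j i with hlt | rfl | hgt
  · rw [if_pos hlt, if_neg (by omega), max_eq_left hlt.le, min_eq_right hlt.le]
  · rw [if_neg (lt_irrefl _), if_pos rfl, if_pos rfl]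
  · rw [if_neg (by omega), if_neg (by omega), if_neg (by omega), max_eq_right hgt.le, min_eq_left hgt.le]

/-- The summand of the streamed row test. [folklore] -/
def rowTerm (Li : List ℤ) (lamZ : ℤ) (i j : ℕ) (t : FI) (Lj : List ℤ) : ℤ :=
  (if j = i then 0 else |(t.lo + t.hi) * 32768 - dotZ Li Lj - (if i = j then lamZ * 32768 else 0)|) +
    32768 * (t.hi - t.lo)

/-- The row accumulator is the sum of the summands. [folklore] -/
theorem rowFold_spec (Li : List ℤ) (lamZ : ℤ) (i : ℕ) : ∀ (ts : List FI) (Ls : List (List ℤ)) (j : ℕ) (acc : ℤ),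
    ts.length ≤ Ls.length →
    rowFold Li lamZ i j ts Ls acc =
      acc + ∑ k ∈ range ts.length, rowTerm Li lamZ i (j + k) (ts.getD k (FI.ofInt 0)) (Ls.getD k [])
  | [], Ls, j, acc, _ => by cases Ls <;> simp [rowFold]
  | t :: ts, [], j, acc, h => by simp at h
  | t :: ts, Lj :: Ls, j, acc, h => by
    rw [rowFold, rowFold_spec Li lamZ i ts Ls (j + 1) _ (by simpa using h), List.length_cons,
      Finset.sum_range_succ']
    have e : ∀ k, j + 1 + k = j + (k + 1) := fun k => by omega
    simp only [e, List.getD_cons_succ, List.getD_cons_zero, Nat.add_zero, rowTerm]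
    ring

/-- **The streamed row test implies the indexed row test** (symmetry of the data turns the half sum into the
full Gershgorin sum of `zcheck`). [folklore] -/
theorem zrowW_of_zrowS {N : ℕ} {utab : List (List FI)} {Lz : List (List ℤ)} {lamZ : ℤ} {i : ℕ}
    (hlen : utab.length = N + 2) (hLz : Lz.length = N) (hi : i < N)
    (h : zrowS utab (dcol utab) Lz lamZ i = true) : zrowW N utab Lz lamZ i = true := by
  have hD : (dcol utab).length = N := by simp [dcol, hlen]
  have htr : (trowD utab (dcol utab) i).length = N := by unfold trowD; rw [trowGo_length, hD]
  simp only [zrowS, decide_eq_true_eq] at h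
  rw [rowFold_spec _ _ _ _ _ _ _ (by rw [htr, hLz]), htr, zero_add, trowD_getD hlen hi hi] at h
  -- identify the summands with the residual entries
  have hterm : ∀ k ∈ range N, rowTerm (Lz.getD i []) lamZ i (0 + k) ((trowD utab (dcol utab) i).getD k (FI.ofInt 0))
      (Lz.getD k []) = (if k = i then 0 else |zresidualW (czOf utab N) Lz lamZ i k|) + 32768 * rzOf utab N i k := by
    intro k hk
    have hk' := mem_range.1 hk
    rw [Nat.zero_add, trowD_getD hlen hi hk', rowTerm, zresidualW, czOf, rzOf, pg_tzTab utab hi hk']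
  rw [Finset.sum_congr rfl hterm, Finset.sum_add_distrib, ← Finset.mul_sum] at h
  have hii : (tEnclF utab i i).lo + (tEnclF utab i i).hi = czOf utab N i i := by
    rw [czOf, pg_tzTab utab hi hi]
  rw [hii] at h
  -- the indexed test
  simp only [zrowW, decide_eq_true_eq, rsum_eq_sum]
  have hR : ∀ a b : ℕ, a < N → b < N →
      mget (mtab N N (zresidualW (czOf utab N) Lz lamZ)) a b = zresidualW (czOf utab N) Lz lamZ a b :=
    fun a b ha hb => mget_mtab _ ha hb
  have h1 : ∑ j ∈ range N, (if j = i then (0 : ℤ) else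
      |mget (mtab N N (zresidualW (czOf utab N) Lz lamZ)) i j| +
        |mget (mtab N N (zresidualW (czOf utab N) Lz lamZ)) j i|) =
      2 * ∑ j ∈ range N, (if j = i then (0 : ℤ) else |zresidualW (czOf utab N) Lz lamZ i j|) := by
    rw [Finset.mul_sum]
    refine Finset.sum_congr rfl fun j hj => ?_
    have hj' := mem_range.1 hj
    rw [hR i j hi hj', hR j i hj' hi, zresidualW_symm utab Lz lamZ hj' hi]
    split_ifs <;> ring
  have h2 : ∑ j ∈ range N, (rzOf utab N i j + rzOf utab N j i) = 2 * ∑ j ∈ range N, rzOf utab N i j := by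
    rw [Finset.mul_sum]
    refine Finset.sum_congr rfl fun j hj => ?_
    rw [rzOf_symm utab (mem_range.1 hj) hi]; ring
  rw [h1, h2, hR i i hi hi]
  have e : zresidualW (czOf utab N) Lz lamZ i i = czOf utab N i i * 32768 - dotZ (Lz.getD i []) (Lz.getD i []) - lamZ * 32768 := by
    simp [zresidualW]
  rw [e]
  linarith

/-- **A streamed chunk decides its rows** (in the indexed form consumed by `posDef_of_rungW`). [folklore] -/
theorem zrowW_of_rowsS {N : ℕ} {utab : List (List FI)} {Lz : List (List ℤ)} {lamZ : ℤ} {i₀ cnt : ℕ}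
    (h : zcheckRowsS N utab Lz lamZ i₀ cnt = true) {i : ℕ} (h1 : i₀ ≤ i) (h2 : i < i₀ + cnt) (hi : i < N) :
    zrowW N utab Lz lamZ i = true := by
  simp only [zcheckRowsS, Bool.and_eq_true, decide_eq_true_eq] at h
  obtain ⟨⟨hlen, hLz⟩, hall⟩ := h
  obtain ⟨t, rfl⟩ : ∃ t, i = i₀ + t := ⟨i - i₀, by omega⟩
  exact zrowW_of_zrowS hlen hLz hi (of_rall hall (k := t) (by omega))

/-! ## Gluing row chunks of a table identity -/

/-- One more chunk: from `(l.drop a).take b = (m.drop a).take b` and the identity beyond `a + b` (the final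
prefix step is `list_eq_of_chunks₂` of `IntegerScrewRung32`). [folklore] -/
theorem drop_eq_of_chunk {α : Type*} {l m : List α} (a b : ℕ) (h1 : (l.drop a).take b = (m.drop a).take b)
    (h2 : l.drop (a + b) = m.drop (a + b)) : l.drop a = m.drop a := by
  rw [← List.take_append_drop b (l.drop a), ← List.take_append_drop b (m.drop a), h1, List.drop_drop,
    List.drop_drop, h2]

end Summit.RiemannHypothesis.RiemannHypothesis.Theorems.IntegerScrew.RungCert
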